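import Summits.Langlands.Langlands.Theses.SkinnerWilesDefectOne
import Summits.Langlands.Langlands.Theorems.SkinnerWilesDefectOneProModularOrdinaryClassicalCmInducedCuspidal
import Summits.Langlands.Langlands.Theorems.SkinnerWilesDefectOneProModularOrdinaryClassicalCmSatakeFrobGlue
import Summits.Langlands.Langlands.Theorems.SkinnerWilesDefectOneProModularOrdinaryClassicalSlopeZeroFactorisation
import Summits.Langlands.Langlands.Theorems.SkinnerWilesDefectOneProModularOrdinaryClassicalOrdinaryExit
import Summits.Langlands.Langlands.Theorems.SkinnerWilesDefectOneProModularOrdinaryClassicalOfBianchiFinitenessHidaFinite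
import Summits.Langlands.Langlands.Theorems.IrreducibilityBySelfDualityRegularTwistCMModuloInputs
import HarnessLib

/-!
# Route `SkinnerWilesDefectOne` — glue BIANCHI-FINITENESS → EXIT
# (`ProModularOrdinaryClassicalGivenBianchiFiniteness`, stmt-Langlands-15365)

The support item `ProModularOrdinaryClassicalGivenBianchiFiniteness` of route `SkinnerWilesDefectOne` is
`BianchiCongruenceCohomologyFinite → ProModularOrdinaryClassical`: the EXIT crux (stmt-Langlands-12921) GIVEN
Borel–Serre finiteness for `GL₂` over imaginary quadratic fields (the crux stmt-Langlands-15362).  Its content is the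
picked line `Cruxes/ProModularOrdinaryClassical/Lines/top_degree_exact_control.lean` (lead's skeleton rev 6) run with
the fact-stub 3a (`stub_fact_borelSerreCongruence` = the ALL-`n`, ALL-fields named fact
`BorelSerre1973_finite_groupCohomology_congruenceSubgroup`) discharged from the ITEM `BianchiCongruenceCohomologyFinite`
instead.  This helper file (`--supports stmt-Langlands-15365`) lands exactly the part of that content which is
provable today (plus one import):

* (imported, landed by the sibling item stmt-Langlands-15746 as p112149:
  `SkinnerWilesDefectOne.BianchiFiniteness.hidaCohomology_finite_of_bianchi`) — stub 3 of the line
  (`Finite (𝒰.hidaCohomology ℤ ι)`, the finiteness of the pieces `H^i(X_{U(r)}, ℤ/p^s)` of the Hida tower that makes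
  Hida's idempotent exist, KhareThorne2017 Lemma 2.10 = the landed `stub_slopeZeroFactorisation`) AT AN IMAGINARY
  QUADRATIC FIELD, from the item, by the in-tree Shapiro reduction over the finitely many components;
* `bianchiCongruenceCohomologyFinite_of_borelSerre` — conversely the all-`n` named fact gives the item (one line),
  so the rewiring loses nothing;
* `proModularOrdinaryClassicalGivenBianchiFiniteness_of_crux` — the item is trivially implied by the exit crux;
* `cmInducedCuspidal_of_two_facts` — the landed CM stub 1b with its third printed input (existence of infinity types
  for every `GL_n` datum) DISCHARGED: its proof uses it only at `n = 2`, where the tree proves it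
  (`RegularTwistCM.exists_hasInfinityType_gl_two`);
* `proModularOrdinaryClassicalGivenBianchiFiniteness_of_ordinaryFactorisation` — THE REWIRED COMPOSITION: the item
  follows from (i) the line's open core, stub 1 `stub_ordinaryFactorisationIwahoriNonCM` ((OF_Iw), Galois-ordinary ⇒
  a slope-zero point of the Hida tower with finite-order slot-`0` diamond character, for non-CM `ρ`; ordinary
  local–global compatibility for completed cohomology of `GL₂` over an imaginary quadratic field in the Galois ⇒ Hecke
  direction — OPEN, taken verbatim as a hypothesis), (ii) the two remaining printed automorphic-induction facts of
  fact-stub 1d and (iii) the three printed Bianchi facts of fact-stub 4, using `cmInducedCuspidal_of_two_facts`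
  (for the landed stub 1b), the LANDED stubs 1c `stub_cmSatakeFrobGlue` and 2 `stub_slopeZeroFactorisation`, the landed
  exit `classical_of_ordinaryPoint`, and the imported `hidaCohomology_finite_of_bianchi` in place of stub 3/3a.  So, kernel-checked and sorry-free: the
  item = {(OF_Iw-nonCM)} + five named Literature facts; no Borel–Serre in general, no rank-`n` infinity types.

Nothing here is new mathematics; the open core (OF) is untouched (crux NOTES §1–3, Disproof §0: it is
Fontaine–Mazur (B) in its sector plus `hpm`).
-/

set_option linter.dupNamespace false -- project-wide option; `Summit.Langlands.Langlands` is the mandated namespace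

noncomputable section

namespace Summit.Langlands.Langlands.Theorems.SkinnerWilesDefectOne.GivenBianchiFiniteness

open Summit.Langlands.Langlands.Theses.SkinnerWilesDefectOne
open Summit.Langlands.Langlands.Cruxes.ProModularOrdinaryClassical.TopDegreeExactControl
open Summit.Langlands.Langlands.Theorems.SkinnerWilesDefectOne.BianchiFiniteness
open Summit.Langlands.Langlands.Theorems.RegularTwistCM (exists_hasInfinityType_gl_two)
open Literature.NumberTheory.Automorphic Literature.NumberTheory.GaloisRepresentations
open Literature.NumberTheory.Automorphic.BigHeckeGLn
open NumberField IsDedekindDomain Filter Polynomial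
-- the place subtypes indexing `mixedSpace K` are `Fintype` classically (`NormedCommRing (mixedSpace K)`)
open scoped Classical

/-- **The all-`n`, all-fields Borel–Serre named fact implies the route item `BianchiCongruenceCohomologyFinite`**
(its `n = 2`, imaginary-quadratic instance): so discharging the line's fact-stub 3a from the item instead of the
Literature constant loses nothing. [cite: BorelSerre1973, §11.1]
[cite: Serre1971CohomologieGroupesDiscrets, §2.4 Th. 4 (a)] -/
theorem bianchiCongruenceCohomologyFinite_of_borelSerre
    (h : BorelSerre1973_finite_groupCohomology_congruenceSubgroup) : BianchiCongruenceCohomologyFinite :=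
  fun K _ _ _ _ U hU hUc A hA q => h 2 K U hU hUc A hA q

/-- **The item is trivially implied by the exit crux** `ProModularOrdinaryClassical` (forget the Bianchi
hypothesis). [folklore] -/
theorem proModularOrdinaryClassicalGivenBianchiFiniteness_of_crux (h : ProModularOrdinaryClassical) :
    ProModularOrdinaryClassicalGivenBianchiFiniteness :=
  fun _ => h

/-- **Stub 1b `stub_cmInducedCuspidal` with its third printed input DISCHARGED** (the CM regime of the line, modulo
only (A) `automorphicInduction_cyclic_cuspidal` and (B) `Henniart2012_infinityType_of_automorphicInduction`).  The
landed stub (Theorems/…CmInducedCuspidal.lean) takes as hypothesis (C) the existence of an infinity type for EVERY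
`GL_n` datum over every number field, but its proof consumes (C) only at `n = 2` (for the induced `π` on
`GL₂(𝔸_F)`), where it is a THEOREM of the tree: `RegularTwistCM.exists_hasInfinityType_gl_two` (Clozel 1990 §3.3
at rank 2, proved from the `(𝔤, K)`-module analysis of the line `petersson-hermitian-purity`).  Statement: for
`K/F` quadratic and `θ` an algebraic Hecke character of `K` with `θ(ϖ_{w'}) ≠ θ(ϖ_w)` for infinitely many pairs of
places over one place of `F`, there is an L-algebraic CUSPIDAL `π` on `GL₂(𝔸_F)` with Satake polynomial
`∏_{w ∣ v} (X^{f(w|v)} − θ(ϖ_w))` at almost every `v`.  Proof: the body of `stub_cmInducedCuspidal` verbatim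
(`π := AI_K^F(π_θ)` from (A) at `n = 1`, not Galois-stable by regularity; Satake clause = Def. 6.1 at `n = 1`;
the integral infinity type of `θ` induced through (B)) with `hIT 2 F hcpt P.1` replaced by
`exists_hasInfinityType_gl_two P.1`.
-- adapted from Theorems/SkinnerWilesDefectOneProModularOrdinaryClassicalCmInducedCuspidal.lean (stub 1b, rev 6)
[cite: ArthurClozelAMS120, Ch. 3 Thm. 6.2 and Lemma 6.4] [cite: Henniart2012, §1.10, Thm. 3 (i), Thm. 5]
[cite: Clozel1990, §3.3] [cite: BuzzardGee2014, Definition 3.1.1] -/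
theorem cmInducedCuspidal_of_two_facts (hAIc : Literature.NumberTheory.Automorphic.automorphicInduction_cyclic_cuspidal)
    (hHen : Literature.NumberTheory.Automorphic.Henniart2012_infinityType_of_automorphicInduction)
    (F : Type) [Field F] [NumberField F] (hcpt : isCompact_glFiniteIntegralLevel 2 F)
    (K : Type) [Field K] [NumberField K] [Algebra F K] (hK2 : Module.finrank F K = 2) (θ : HeckeCharacter K)
    (halg : θ.IsAlgebraic)
    (hreg : ∃ᶠ w : HeightOneSpectrum (𝓞 K) in cofinite, ∃ w' : HeightOneSpectrum (𝓞 K),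
      w'.asIdeal.under (𝓞 F) = w.asIdeal.under (𝓞 F) ∧ θ.valueAtUniformizer w' ≠ θ.valueAtUniformizer w) :
    ∃ π : CuspidalAutomorphicRepData 2 F hcpt, π.1.IsLAlgebraic ∧
      ∀ᶠ v : HeightOneSpectrum (𝓞 F) in cofinite, ∃ α : Multiset ℂ, π.1.HasSatakeParamAt v α ∧
        satakePolynomial α = ∏ᶠ w ∈ {w : HeightOneSpectrum (𝓞 K) | w.under (𝓞 F) = v},
          (X ^ w.asIdeal.inertiaDeg (𝓞 F) - C (θ.valueAtUniformizer w)) := by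
  -- (1) `K/F` quadratic: Galois, cyclic, of prime degree
  haveI : Algebra.IsQuadraticExtension F K := ⟨hK2⟩
  haveI : Module.Finite F K := Module.Finite.of_restrictScalars_finite ℚ F K
  haveI : Algebra.IsSeparable F K := Algebra.IsSeparable.of_integral F K
  haveI : IsGalois F K := Algebra.IsQuadraticExtension.isGalois F K
  have hcyc : IsCyclic (K ≃ₐ[F] K) := Algebra.IsQuadraticExtension.isCyclic F K
  have hprime : (Module.finrank F K).Prime := by rw [hK2]; exact Nat.prime_two
  -- (2) the datum `π_θ` of `GL₁(𝔸_K)` and its cuspidal automorphic induction (fact (A) at `n = 1`)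
  set hE := isCompact_glFiniteIntegralLevel_holds 1 K
  obtain ⟨τ, hτ⟩ := exists_automorphicRepData_hasSatakeParamAt_valueAtUniformizer hE θ
  have hnst : ¬ IsGaloisStableSatakeAE F τ := not_isGaloisStableSatakeAE_of_frequently_ne θ hτ hreg
  obtain ⟨P, hAI⟩ : ∃ P : CuspidalAutomorphicRepData 2 F hcpt, IsAutomorphicInductionAlong τ P.1 :=
    exists_cuspidal_along_of_eq τ (by rw [hK2]) hcpt
      fun hK => hAIc 1 F K hcyc hprime one_pos hE hK ⟨τ, τ.W_le_cuspFormsGL_one⟩ hnst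
  -- (3) the Satake clause: Def. 6.1 at `n = 1` is the character identity
  have hsat := (isAutomorphicInductionAlong_iff_of_hasSatakeParamAt_singleton θ hτ P.1).1 hAI
  -- (4) L-algebraicity: the integral infinity type of `θ`, induced; the infinity type of `P` EXISTS at rank 2
  obtain ⟨p, q, hpq⟩ := (HeckeCharacter.isAlgebraic_iff_exists_hasInfinityType θ).mp halg
  have hχ := τ.heckeCharacter_of_eventually_hasSatakeParamAt_glOne hτ
  obtain ⟨Tτ, hTτ, hTa⟩ := τ.exists_hasInfinityType_of_hasInfinityType_heckeCharacter_glOne hχ hpq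
  have hTτL : Tτ.IsLAlgebraic :=
    isLAlgebraic_of_map_a_eq_singleton (fun ι => -HeckeCharacter.embExponent p q ι)
      fun ι => by rw [hTa ι]; push_cast; rfl
  obtain ⟨TP, hTP⟩ := exists_hasInfinityType_gl_two P.1
  have hind : P.1.HasInfinityType (Tτ.automorphicInduction F (2 * 1)) :=
    hHen.hasInfinityType_automorphicInduction F K hcyc 1 2 one_pos hK2 hcpt hE P
      ⟨τ, τ.W_le_cuspFormsGL_one⟩ hAI hTP hTτ
  exact ⟨P, ⟨Tτ.automorphicInduction F (2 * 1), hind, hTτL.automorphicInduction⟩, hsat⟩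

/-- **The rewired composition: `ProModularOrdinaryClassicalGivenBianchiFiniteness` from the line's open core (OF_Iw,
non-CM `ρ`) and FIVE printed facts of its fact-stubs 1d and 4 — no Borel–Serre in general, and no existence of
infinity types in general rank.**  Hypotheses, in
order: `hOF` = the registered stub 1 `stub_ordinaryFactorisationIwahoriNonCM` of
`Cruxes/ProModularOrdinaryClassical/Lines/top_degree_exact_control.lean` (rev 6) VERBATIM — for `F` imaginary
quadratic, `p` odd, `ρ` irreducible, not CM-induced through `ι`, a.e. unramified, `p`-adically automorphic of some
tame level and ordinary of parallel weight `k ≥ 2` (exponent `m > 0`) at every `v ∣ p`, there are a tame level `𝒰`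
maximal above `p` and a continuous slope-zero point `y` of the big Hecke algebra of its Hida tower associated with
`ρ` whose slot-`0` diamond character has finite order on the global units above `p` (OPEN: ordinary local–global
compatibility, Galois ⇒ Hecke, for completed cohomology of `GL₂` over an imaginary quadratic field); then the named
facts `automorphicInduction_cyclic_cuspidal` (ArthurClozel Ch. 3 Thm. 6.2), `Henniart2012_infinityType_of_automorphicInduction`,
`hidaControl_dominantOrdinaryPoint` (Hida1994AIF),
`bianchi_interiorEigenclass_isCuspidal` (Harder1987), `bianchi_boundaryEigensystem_isReducible` (Harder1987).
Proof = §3 of the skeleton: case (CM) by `cmInducedCuspidal_of_two_facts` (the landed stub 1b with its input (C)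
discharged at rank 2) + the LANDED stub 1c `stub_cmSatakeFrobGlue`;
case (non-CM): `hOF` gives `(𝒰, y)`, the LANDED stub 2 `stub_slopeZeroFactorisation` — fed with
`hidaCohomology_finite_of_bianchi` (the Bianchi hypothesis, at the crux's own imaginary quadratic `F`) — factors
`y = x ∘ toOrd` through Hida's ordinary algebra, association and diamond values transfer along `toOrd`
(`toOrd_hidaT`, `toOrd_hidaDiamond`), and the LANDED exit `classical_of_ordinaryPoint` yields the L-algebraic cuspidal
`π` with the summit's Satake–Frobenius clause. [folklore] -/
theorem proModularOrdinaryClassicalGivenBianchiFiniteness_of_ordinaryFactorisation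
    (hOF : ∀ (F : Type) [Field F] [NumberField F], NumberField.IsTotallyComplex F → Module.finrank ℚ F = 2 → ∀ (p : ℕ) [Fact p.Prime], p ≠ 2 → ∀ (ι : PadicAlgCl p ≃+* ℂ) (ρ : Literature.NumberTheory.GaloisRepresentations.FramedGaloisRep F (PadicAlgCl p) 2) (k m : ℕ), ρ.toGaloisRep.IsIrreducible → (¬ ∃ (K : Type) (_ : Field K) (_ : NumberField K) (_ : Algebra F K) (_ : Module.finrank F K = 2) (θ : Literature.NumberTheory.GaloisRepresentations.HeckeCharacter K), θ.IsAlgebraic ∧ (∃ᶠ w : IsDedekindDomain.HeightOneSpectrum (NumberField.RingOfIntegers K) in Filter.cofinite, ∃ w' : IsDedekindDomain.HeightOneSpectrum (NumberField.RingOfIntegers K), w'.asIdeal.under (NumberField.RingOfIntegers F) = w.asIdeal.under (NumberField.RingOfIntegers F) ∧ θ.valueAtUniformizer w' ≠ θ.valueAtUniformizer w) ∧ ∀ᶠ v : IsDedekindDomain.HeightOneSpectrum (NumberField.RingOfIntegers F) in Filter.cofinite, ρ.IsUnramifiedAt v ∧ ρ.HasFrobCharpolyAt v (∏ᶠ w ∈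 {w : IsDedekindDomain.HeightOneSpectrum (NumberField.RingOfIntegers K) | w.under (NumberField.RingOfIntegers F) = v}, (Polynomial.X ^ w.asIdeal.inertiaDeg (NumberField.RingOfIntegers F) - Polynomial.C (ι.symm (θ.valueAtUniformizer w)⁻¹)))) → (∀ᶠ v in Filter.cofinite, ρ.IsUnramifiedAt v) → (∃ 𝒰 : Literature.NumberTheory.Automorphic.BigHeckeGLn.TameLevel 2 F p, 𝒰.IsPadicallyAutomorphic ρ) → 2 ≤ k → 0 < m → (∀ v : IsDedekindDomain.HeightOneSpectrum (NumberField.RingOfIntegers F), (p : NumberField.RingOfIntegers F) ∈ v.asIdeal → ρ.IsOrdinaryOfWeightAt p v k m) → ∃ 𝒰 : Literature.NumberTheory.Automorphic.BigHeckeGLn.TameLevel 2 F p, 𝒰.IsMaximalAbove ∧ ∃ y : Literature.NumberTheory.Automorphic.HidaHeckeAlgebraGLn 𝒰 →+* PadicAlgCl p, Continuous y ∧ 𝒰.IsHidaAssociated y ρ ∧ (∀ v : IsDedekindDomain.HeightOneSpectrum (NumberField.RingOfIntegers F), (p : NumberField.RingOfIntegers F) ∈ v.asIdeal → 𝒰.IsSlopeZeroAt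 y v) ∧ ∃ N : ℕ, 0 < N ∧ ∀ (u : NumberField.RingOfIntegers F) (û : ∀ v : IsDedekindDomain.HeightOneSpectrum (NumberField.RingOfIntegers F), (p : NumberField.RingOfIntegers F) ∈ v.asIdeal → (v.adicCompletionIntegers F)ˣ), (∀ (v : IsDedekindDomain.HeightOneSpectrum (NumberField.RingOfIntegers F)) (hv : (p : NumberField.RingOfIntegers F) ∈ v.asIdeal), ((û v hv : v.adicCompletionIntegers F) : v.adicCompletion F) = algebraMap F (v.adicCompletion F) (u : F)) → (∏ᶠ v : {v : IsDedekindDomain.HeightOneSpectrum (NumberField.RingOfIntegers F) // (p : NumberField.RingOfIntegers F) ∈ v.asIdeal}, y (𝒰.hidaDiamond v.2 (Pi.mulSingle (0 : Fin 2) (û v.1 v.2)))) ^ N = 1)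
    (hAI : Literature.NumberTheory.Automorphic.automorphicInduction_cyclic_cuspidal)
    (hHen : Literature.NumberTheory.Automorphic.Henniart2012_infinityType_of_automorphicInduction)
    (hHC : Literature.NumberTheory.Automorphic.hidaControl_dominantOrdinaryPoint)
    (hInt : Literature.NumberTheory.Automorphic.bianchi_interiorEigenclass_isCuspidal)
    (hBdry : Literature.NumberTheory.Automorphic.bianchi_boundaryEigensystem_isReducible) :
    ProModularOrdinaryClassicalGivenBianchiFiniteness := by
  intro hB F _ _ hF hdeg p _ hp hcpt ι ρ hirr hunr hpm hord
  by_cases hcm : ∃ (K : Type) (_ : Field K) (_ : NumberField K) (_ : Algebra F K) (_ : Module.finrank F K = 2)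
      (θ : HeckeCharacter K), θ.IsAlgebraic ∧
        (∃ᶠ w : HeightOneSpectrum (𝓞 K) in cofinite, ∃ w' : HeightOneSpectrum (𝓞 K),
          w'.asIdeal.under (𝓞 F) = w.asIdeal.under (𝓞 F) ∧ θ.valueAtUniformizer w' ≠ θ.valueAtUniformizer w) ∧
        ∀ᶠ v : HeightOneSpectrum (𝓞 F) in cofinite, ρ.IsUnramifiedAt v ∧
          ρ.HasFrobCharpolyAt v (∏ᶠ w ∈ {w : HeightOneSpectrum (𝓞 K) | w.under (𝓞 F) = v},
            (X ^ w.asIdeal.inertiaDeg (𝓞 F) - C (ι.symm (θ.valueAtUniformizer w)⁻¹)))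
  · -- the CM regime: cuspidal automorphic induction of `θ` (stub 1b with (C) discharged, landed 1c; facts (A), (B)),
    -- no (OF) and no finiteness
    obtain ⟨K, iK, iN, iA, hK, θ, halg, hreg, hfrob⟩ := hcm
    obtain ⟨π, hLalg, hsat⟩ := @cmInducedCuspidal_of_two_facts hAI hHen F _ _ hcpt K iK iN iA hK θ halg hreg
    exact ⟨π, hLalg, @stub_cmSatakeFrobGlue F _ _ p _ hcpt ι ρ K iK iN iA hK θ π hsat hfrob⟩
  · -- the non-CM regime: (OF_Iw-nonCM) + KT 2.10 (landed stub 2) fed with the Bianchi finiteness of the Hida pieces,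
    -- then the landed exit `classical_of_ordinaryPoint` (facts 4)
    obtain ⟨k, hk, m, hm, hv⟩ := hord
    obtain ⟨𝒰, h𝒰, y, hy, hass, hslope, N, hN, hslot⟩ :=
      hOF F hF hdeg p hp ι ρ k m hirr hcm hunr hpm hk hm hv
    obtain ⟨x, hx, hxy⟩ :=
      stub_slopeZeroFactorisation F p 𝒰 h𝒰 (hidaCohomology_finite_of_bianchi hB F hdeg hF p 𝒰) y hy hslope
    have hassx : 𝒰.IsOrdAssociated x ρ := by
      -- association transfers along `toOrd` (`toOrd T_{w,j} = T_{w,j}`)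
      have hfun : (fun w j => x (𝒰.ordT w j)) = fun w j => y (𝒰.hidaT w j) := by
        funext w j
        rw [← hxy, RingHom.comp_apply, TameLevel.toOrd_hidaT]
      show IsAssociatedFamily 2 𝒰.bad (fun w j => x (𝒰.ordT w j)) ρ
      rw [hfun]
      exact hass
    have hslotx : ∃ N : ℕ, 0 < N ∧ ∀ (u : 𝓞 F)
        (û : ∀ v : HeightOneSpectrum (𝓞 F), (p : 𝓞 F) ∈ v.asIdeal → (v.adicCompletionIntegers F)ˣ),
        (∀ (v : HeightOneSpectrum (𝓞 F)) (hv : (p : 𝓞 F) ∈ v.asIdeal),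
          ((û v hv : v.adicCompletionIntegers F) : v.adicCompletion F) = algebraMap F (v.adicCompletion F) (u : F)) →
        (∏ᶠ v : {v : HeightOneSpectrum (𝓞 F) // (p : 𝓞 F) ∈ v.asIdeal},
          x (𝒰.ordDiamond v.2 (Pi.mulSingle (0 : Fin 2) (û v.1 v.2)))) ^ N = 1 := by
      refine ⟨N, hN, fun u û hû => ?_⟩
      -- the diamond values transfer along `toOrd` (`toOrd ⟨u⟩ = ⟨u⟩`)
      have hdia : ∀ v : {v : HeightOneSpectrum (𝓞 F) // (p : 𝓞 F) ∈ v.asIdeal},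
          x (𝒰.ordDiamond v.2 (Pi.mulSingle (0 : Fin 2) (û v.1 v.2))) =
            y (𝒰.hidaDiamond v.2 (Pi.mulSingle (0 : Fin 2) (û v.1 v.2))) := by
        intro v
        rw [← hxy, RingHom.comp_apply, TameLevel.toOrd_hidaDiamond]
      simp only [hdia]
      exact hslot u û hû
    exact classical_of_ordinaryPoint hHC hInt hBdry F hF hdeg p hp hcpt ι ρ 𝒰 x k m hirr h𝒰 hx hassx hk hm hv hslotx

end Summit.Langlands.Langlands.Theorems.SkinnerWilesDefectOne.GivenBianchiFiniteness

end
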